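/-
Copyright (c) 2026 the pub-hodgecm2 formalisation cell (harness21).  New file, not vendored.
Origin: seat `prover-pub-hodgecm2-d2bridge-wb-10-g3-0` (wall-breaker wb-10, TRANSPORT route), 2026-08-24: the admissibility law of the
record involution `conjRecord` (wb-5 g1, ✔ `D2Bridge/LiuCMSideConj`), derived on paper by wb-2 g1 («T3″ pair-b», pub-hodgecm2/INBOX
l.12240) and named as the missing «reflex-lift-of-`c·S`» step by wb-5 g1 (l.12303).  Audit record under WORLD = C (coordinator l.12481).
HC_CM is NOT proved; «Δ2 BRIDGE CLOSED» is NOT claimed; theorems only — no definition, no instance, no named fact, no `sorry`.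
-/
import Summits.HodgeConjecture.CorCM.D2Bridge.LiuCMSideConj
import Summits.HodgeConjecture.CorCM.D2Bridge.ReflexOfTypeConj
import HarnessLib

/-!
# Δ2 bridge, orientation calculus: the record involution `d ↦ d̄` FLIPS the admissible type — `d̄` is `(ι, Φ)`-admissible iff `d` is `(ι, Φ̄)`-admissible

`conjRecord d = d̄` (✔ `LiuCMSideConj`, wb-5 g1) keeps the abelian variety, its CM structure and the reflex pair `(K', Φ', k)` of a CM
record `d : LiuCMSide` and conjugates the eigencharacter `τ ↦ conj ∘ τ` and the class `α ↦ (conj ⊗ id) α`.  The admissibility predicate of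
the (J3)/§4.3 dictionaries, `d.IsReflexOfType ι Φ := d.IsReflexOf ι (autSet ι Φ)` ([Liu2021] Def. 4.3 via [Shimura1998] §8.3 Prop. 28:
`(K', Φ')` is the reflex pair of `(L, Φ)` read through `ι`, `τ ∘ k = ι` on the reflex field), was known to be blind to conjugating the
PIN at a fixed type set (✔ `isReflexOf_conj_iff`, K1 `isReflexOfType_conj_iff : d.IsReflexOfType ῑ Φ ↔ d.IsReflexOfType ι Φ̄`).  This file
proves what conjugating the RECORD does:

* §1 the type sets: `autSet ι Φ̄ = ρ⁻¹ · autSet ι Φ` elementwise (`ρ = conjGal`, the complex conjugation of `L` in `Aut_ℚ(L)`, central),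
  hence `↑'' autSet ι Φ̄ = ρ • ↑'' autSet ι Φ`, equal stabilisers, **equal reflex fields** `reflexFieldOf (autSet ι Φ̄) = reflexFieldOf (autSet ι Φ)`,
  and reflex lifts related by `g ∈ S̃*(Φ̄) ↔ g ρ ∈ S̃*(Φ)` — the «reflex-lift-of-`c·S`» step;
* §2 the transport: for type sets `T, T'` with the same reflex field and `S̃*(T') = S̃*(T) ρ`,
  **`d̄.IsReflexOf ι T ↔ d.IsReflexOf ι T'`** (`isReflexOf_conjRecord_iff_of_reflexLift`) — through K1's `d̄.IsReflexOf ι T ↔ d̄.IsReflexOf ῑ T`,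
  clause (i) `conj ∘ τ ∘ k = ῑ ∘ incl ∘ ε ↔ τ ∘ k = ι ∘ incl ∘ ε` and clause (ii) `reflexTypeC ῑ T = reflexTypeC ι T'` read over `L`;
* §3 **`isReflexOfType_conjRecord_iff : d̄.IsReflexOfType ι Φ ↔ d.IsReflexOfType ι Φ̄`** (`↔ d.IsReflexOfType ῑ Φ` by K1), the
  `IsReflexOfTypeG` forms, and the symmetric forms (`d̄̄ = d`);
* §4 generator sets: wb-5 g1's frame `cmClasses_eq_image_conj_of_adm_conjRecord` now FIRES BY VALUE — two dictionaries at one pin keyed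
  `(ι₁, Φ)` and `(ῑ₁, Φ)` (equivalently `(ι₁, Φ)` and `(ι₁, Φ̄)`) at characters `μ, μf` have `cmClasses′ K μf = (conj ⊗ id) '' cmClasses K μ`
  ON THE NOSE; at the literal pin: the HYBRID∕re-keyed generator set of a line is the complex conjugate of the LIVE one of the SAME line
  (`cmClasses_conjAdm_pin_eq_image_conj` — «T♭ = 𝔇ʰ as sets», wb-1∕wb-2∕wb-5 g1), and the LIVE generator sets of a line and of a line of
  conjugate type are complex conjugates (`cmClasses_pin_eq_image_conj_of_lineType_eq_bar`).

Reading (prose, nothing asserted): re-keying the admissibility of a line from `ι₁` to `ῑ₁` is the same as conjugating every admissible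
record, hence conjugates the generator set class by class (`(1,0) ↔ (0,1)`); it is NOT a relabeling of lines.  Kernel only.

References: [Liu2021] Y. Liu, *Fourier–Jacobi cycles and arithmetic relative trace formula*, Camb. J. Math. 9 (2021), Def. 4.3, Rem. 4.4;
[Shimura1998] G. Shimura, *Abelian Varieties with Complex Multiplication and Modular Functions*, §8.3 Prop. 28; [VoisinHodgeI2002]
C. Voisin, *Hodge Theory and Complex Algebraic Geometry I*, §6.1.3 Cor. 6.12.
-/

set_option autoImplicit false

noncomputable section

open scoped Pointwise ComplexConjugate
open NumberField NumberField.ComplexEmbedding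
open Literature.AlgebraicGeometry.Motives (CMType)
open Literature.NumberTheory.ComplexMultiplication
open HodgeCM.CMTypeOps (bar)
open HodgeCM.Model (LiuCMSide)
open HodgeCM.Model.LiuCMSide (autImage reflexFieldOf reflexTypeC autSet)

namespace Summit.HodgeConjecture.CorCM.D2Bridge

variable {L : HodgeCM.CMField}

/-! ## §0 The complex conjugation `ρ = conjGal ∈ Aut_ℚ(L)`: `ρ⁻¹ = ρ` -/

/-- `ρ⁻¹ = ρ` for the complex conjugation of the CM field `L` in `Aut_ℚ(L)`. [folklore] -/
theorem conjGal_inv : (conjGal : (L : Type) ≃ₐ[ℚ] L)⁻¹ = conjGal :=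
  inv_eq_of_mul_eq_one_right conjGal_mul_conjGal

/-- `ρ g ρ = g` (`ρ` central of order two). [folklore] -/
theorem conjGal_mul_mul_conjGal (g : (L : Type) ≃ₐ[ℚ] L) :
    (conjGal : (L : Type) ≃ₐ[ℚ] L) * g * conjGal = g := by
  rw [mul_assoc, ← conjGal_central g, ← mul_assoc, conjGal_mul_conjGal, one_mul]

/-! ## §1 The type sets `autSet ι Φ̄` versus `autSet ι Φ`: translate by `ρ`; same reflex field; reflex lifts translate by `ρ` -/

/-- **`g ∈ autSet ι Φ̄ ↔ ρ g ∈ autSet ι Φ`**: `ι ∘ g ∈ Φ̄ ↔ conj ∘ ι ∘ g ∈ Φ ↔ ι ∘ (ρ g) ∈ Φ`. [cite: Liu2021, Remark 4.4] -/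
theorem mem_autSet_bar_iff (ι : (L : Type) →+* ℂ) (Φ : CMType L) (g : (L : Type) ≃ₐ[ℚ] L) :
    g ∈ autSet ι (bar Φ) ↔ (conjGal : (L : Type) ≃ₐ[ℚ] L) * g ∈ autSet ι Φ := by
  rw [← autSet_conj ι Φ]
  change ((starRingEnd ℂ).comp ι).comp g.toRingEquiv.toRingHom ∈ Φ.1 ↔
    ι.comp ((conjGal : (L : Type) ≃ₐ[ℚ] L) * g).toRingEquiv.toRingHom ∈ Φ.1
  have h : ((starRingEnd ℂ).comp ι).comp g.toRingEquiv.toRingHom =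
      ι.comp ((conjGal : (L : Type) ≃ₐ[ℚ] L) * g).toRingEquiv.toRingHom :=
    RingHom.ext fun x => by
      change conj (ι (g x)) = ι ((conjGal : (L : Type) ≃ₐ[ℚ] L) (g x))
      rw [apply_conjGal_eq_conj]
  rw [h]

/-- `g • id ∈ ↑'' T ↔ g ∈ T` (the coercion `Aut_ℚ(L) → End_ℚ(L)` is injective). [folklore] -/
theorem smul_id_mem_autImage_iff (T : Set ((L : Type) ≃ₐ[ℚ] L)) (g : (L : Type) ≃ₐ[ℚ] L) :
    g • AlgHom.id ℚ (L : Type) ∈ autImage T ↔ g ∈ T := by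
  constructor
  · rintro ⟨g', hg', e⟩
    have e' : (g' : (L : Type) →ₐ[ℚ] L) = (g : (L : Type) →ₐ[ℚ] L) := by
      change (g' : (L : Type) →ₐ[ℚ] L) = g • AlgHom.id ℚ (L : Type) at e
      rw [e, algEquiv_smul_def, AlgHom.comp_id]
    exact AlgEquiv.coe_toAlgHom_injective e' ▸ hg'
  · intro hg
    refine ⟨g, hg, ?_⟩
    change (g : (L : Type) →ₐ[ℚ] L) = g • AlgHom.id ℚ (L : Type)
    rw [algEquiv_smul_def, AlgHom.comp_id]

/-- **`↑'' autSet ι Φ̄ = ρ • ↑'' autSet ι Φ`** (as sets of `ℚ`-algebra endomorphisms of `L`; `ρ² = 1`). [cite: Liu2021, Remark 4.4] -/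
theorem autImage_autSet_bar_eq (ι : (L : Type) →+* ℂ) (Φ : CMType L) :
    autImage (autSet ι (bar Φ)) = (conjGal : (L : Type) ≃ₐ[ℚ] L) • autImage (autSet ι Φ) := by
  ext φ
  simp only [Set.mem_image, Set.mem_smul_set]
  constructor
  · rintro ⟨g, hg, rfl⟩
    refine ⟨(((conjGal : (L : Type) ≃ₐ[ℚ] L) * g : (L : Type) ≃ₐ[ℚ] L) : (L : Type) →ₐ[ℚ] L),
      ⟨conjGal * g, (mem_autSet_bar_iff ι Φ g).1 hg, rfl⟩, ?_⟩
    rw [algEquiv_smul_def]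
    refine AlgHom.ext fun x => ?_
    change (conjGal : (L : Type) ≃ₐ[ℚ] L) ((conjGal : (L : Type) ≃ₐ[ℚ] L) (g x)) = g x
    rw [conjGal_apply, conjGal_apply, IsCMField.complexConj_apply_apply]
  · rintro ⟨ψ, ⟨h, hh, rfl⟩, rfl⟩
    refine ⟨conjGal * h, (mem_autSet_bar_iff ι Φ _).2 ?_, ?_⟩
    · rwa [← mul_assoc, conjGal_mul_conjGal, one_mul]
    · rw [algEquiv_smul_def]
      exact AlgHom.ext fun _ => rfl

/-- The stabilisers `H*` of the two type sets agree (`ρ` is central). [cite: Shimura1998, §8.3 Prop. 28] -/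
theorem stabilizer_autImage_autSet_bar_eq (ι : (L : Type) →+* ℂ) (Φ : CMType L) :
    MulAction.stabilizer ((L : Type) ≃ₐ[ℚ] L) (autImage (autSet ι (bar Φ))) =
      MulAction.stabilizer ((L : Type) ≃ₐ[ℚ] L) (autImage (autSet ι Φ)) := by
  ext σ
  rw [MulAction.mem_stabilizer_iff, MulAction.mem_stabilizer_iff, autImage_autSet_bar_eq ι Φ, smul_smul,
    ← conjGal_central σ, ← smul_smul, smul_left_cancel_iff]

/-- **Same reflex field**: `reflexFieldOf (autSet ι Φ̄) = reflexFieldOf (autSet ι Φ)` — [Liu2021] Rem. 4.4 «`M'_{μ^c} = M'_μ`» in the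
package's typing. [cite: Liu2021, Remark 4.4] [cite: Shimura1998, §8.3 Prop. 28] -/
theorem reflexFieldOf_autSet_bar_eq (ι : (L : Type) →+* ℂ) (Φ : CMType L) :
    reflexFieldOf (autSet ι (bar Φ)) = reflexFieldOf (autSet ι Φ) := by
  change IntermediateField.fixedField _ = IntermediateField.fixedField _
  rw [stabilizer_autImage_autSet_bar_eq ι Φ]

/-- **Reflex lifts translate by `ρ`**: `g ∈ S̃*(autSet ι Φ̄) ↔ g ρ ∈ S̃*(autSet ι Φ)` (`S̃* = S⁻¹`). [cite: Shimura1998, §8.3 Prop. 28] -/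
theorem mem_reflexLift_autSet_bar_iff (ι : (L : Type) →+* ℂ) (Φ : CMType L) (g : (L : Type) ≃ₐ[ℚ] L) :
    g ∈ reflexLift (autImage (autSet ι (bar Φ))) (AlgHom.id ℚ (L : Type)) ↔
      g * conjGal ∈ reflexLift (autImage (autSet ι Φ)) (AlgHom.id ℚ (L : Type)) := by
  rw [mem_reflexLift, mem_reflexLift, smul_id_mem_autImage_iff, smul_id_mem_autImage_iff, mem_autSet_bar_iff,
    mul_inv_rev, conjGal_inv]

/-! ## §2 The reflex type read over `L`, and the transport `d̄.IsReflexOf ι T ↔ d.IsReflexOf ι T'` -/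

/-- Membership in the package reflex type, pointwise over `L`: `χ ∈ reflexTypeC ι T ↔ ∃ g ∈ S̃*(T), ∀ y, χ y = ι (g y)`. [folklore] -/
theorem mem_reflexTypeC_iff_exists_forall (ι : (L : Type) →+* ℂ) (T : Set ((L : Type) ≃ₐ[ℚ] L))
    (χ : ↥(reflexFieldOf T) →+* ℂ) :
    χ ∈ reflexTypeC ι T ↔
      ∃ g : (L : Type) ≃ₐ[ℚ] L, g ∈ reflexLift (autImage T) (AlgHom.id ℚ (L : Type)) ∧
        ∀ y : ↥(reflexFieldOf T), χ y = ι (g (y : L)) := by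
  refine exists_congr fun g => and_congr_right fun _ => ?_
  constructor
  · intro h y
    rw [h]
    rfl
  · intro h
    exact RingHom.ext fun y => h y

/-- `IsReflexOf` of the conjugate record, unfolded over the fields of `d` (only `τ` moves: `τ ↦ conj ∘ τ`). [folklore] -/
theorem isReflexOf_conjRecord_iff_exists (ι : (L : Type) →+* ℂ) (C : LiuCMSide) (T : Set ((L : Type) ≃ₐ[ℚ] L)) :
    (conjRecord C).IsReflexOf ι T ↔
      ∃ ε : C.K' ≃+* ↥(reflexFieldOf T),
        ((starRingEnd ℂ).comp C.τ).comp C.k = (ι.comp (algebraMap (↥(reflexFieldOf T)) L)).comp ε.toRingHom ∧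
          ∀ ψ : C.K' →+* ℂ, ψ ∈ C.Φ' ↔ ψ.comp ε.symm.toRingHom ∈ reflexTypeC ι T :=
  Iff.rfl

/-- **THE TRANSPORT.**  For type sets `T, T' ⊆ Aut_ℚ(L)` with the same reflex field and reflex lifts related by `g ∈ S̃*(T') ↔ g ρ ∈ S̃*(T)`:
the conjugate record `d̄` is the reflex side of `T` through `ι` iff `d` is the reflex side of `T'` through `ι`.  Via K1
(`d̄.IsReflexOf ι T ↔ d̄.IsReflexOf ῑ T`): clause (i) `conj ∘ τ ∘ k = ῑ ∘ incl ∘ ε ↔ τ ∘ k = ι ∘ incl ∘ ε`; clause (ii)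
`reflexTypeC ῑ T = {ι ∘ (ρ g)|, g ∈ S̃*(T)} = reflexTypeC ι T'` over the common reflex field. [cite: Shimura1998, §8.3 Prop. 28] -/
theorem isReflexOf_conjRecord_iff_of_reflexLift (ι : (L : Type) →+* ℂ) (C : LiuCMSide) (T T' : Set ((L : Type) ≃ₐ[ℚ] L))
    (hE : reflexFieldOf T' = reflexFieldOf T)
    (hR : ∀ g : (L : Type) ≃ₐ[ℚ] L, g ∈ reflexLift (autImage T') (AlgHom.id ℚ (L : Type)) ↔
      g * conjGal ∈ reflexLift (autImage T) (AlgHom.id ℚ (L : Type))) :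
    (conjRecord C).IsReflexOf ι T ↔ C.IsReflexOf ι T' := by
  rw [← isReflexOf_conj_iff ι (conjRecord C) T, isReflexOf_conjRecord_iff_exists]
  -- the identification of the two (equal) reflex fields, over `L`
  let e : ↥(reflexFieldOf T') ≃ₐ[ℚ] ↥(reflexFieldOf T) := IntermediateField.equivOfEq hE
  have e_val : ∀ y : ↥(reflexFieldOf T'), ((e y : ↥(reflexFieldOf T)) : L) = (y : L) := fun _ => rfl
  have e_symm_val : ∀ y : ↥(reflexFieldOf T), ((e.symm y : ↥(reflexFieldOf T')) : L) = (y : L) := by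
    intro y
    have h := e_val (e.symm y)
    rw [AlgEquiv.apply_symm_apply] at h
    exact h.symm
  -- clause (ii): the reflex type of `T` through `ῑ` IS the reflex type of `T'` through `ι`, read over `L`
  have key : ∀ χ : ↥(reflexFieldOf T) →+* ℂ,
      χ ∈ reflexTypeC ((starRingEnd ℂ).comp ι) T ↔ χ.comp (e : ↥(reflexFieldOf T') →+* ↥(reflexFieldOf T)) ∈ reflexTypeC ι T' := by
    intro χ
    rw [mem_reflexTypeC_iff_exists_forall, mem_reflexTypeC_iff_exists_forall]
    constructor
    · rintro ⟨g, hg, hχ⟩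
      refine ⟨conjGal * g, (hR _).2 (by rwa [conjGal_mul_mul_conjGal]), fun y => ?_⟩
      change χ (e y) = ι (((conjGal : (L : Type) ≃ₐ[ℚ] L) * g) (y : L))
      rw [hχ (e y), e_val, AlgEquiv.mul_apply, apply_conjGal_eq_conj, RingHom.comp_apply]
    · rintro ⟨g', hg', hχ⟩
      refine ⟨conjGal * g', ?_, fun y => ?_⟩
      · have h := (hR g').1 hg'
        rwa [← conjGal_central g'] at h
      · have h1 : χ y = (χ.comp (e : ↥(reflexFieldOf T') →+* ↥(reflexFieldOf T))) (e.symm y) := by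
          change χ y = χ (e (e.symm y))
          rw [AlgEquiv.apply_symm_apply]
        rw [h1, hχ (e.symm y), e_symm_val, AlgEquiv.mul_apply, RingHom.comp_apply, apply_conjGal_eq_conj,
          starRingEnd_self_apply]
  constructor
  · rintro ⟨ε, hτ, hΦ⟩
    refine ⟨ε.trans (e.symm : ↥(reflexFieldOf T) ≃ₐ[ℚ] ↥(reflexFieldOf T')).toRingEquiv, ?_, fun ψ => ?_⟩
    · refine RingHom.ext fun x => ?_
      have hx := RingHom.congr_fun hτ x
      apply (starRingEnd ℂ).injective
      change conj (C.τ (C.k x)) = conj (ι ((ε x : ↥(reflexFieldOf T)) : L)) at hx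
      change conj (C.τ (C.k x)) = conj (ι ((e.symm (ε x) : ↥(reflexFieldOf T')) : L))
      rw [e_symm_val]
      exact hx
    · rw [hΦ ψ]
      have hs : ψ.comp (ε.trans (e.symm : ↥(reflexFieldOf T) ≃ₐ[ℚ] ↥(reflexFieldOf T')).toRingEquiv).symm.toRingHom =
          (ψ.comp ε.symm.toRingHom).comp (e : ↥(reflexFieldOf T') →+* ↥(reflexFieldOf T)) :=
        RingHom.ext fun y => by
          change ψ ((ε.trans (e.symm : ↥(reflexFieldOf T) ≃ₐ[ℚ] ↥(reflexFieldOf T')).toRingEquiv).symm y) = ψ (ε.symm (e y))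
          rw [RingEquiv.symm_trans_apply]
          rfl
      rw [hs]
      exact key _
  · rintro ⟨ε', hτ', hΦ'⟩
    refine ⟨ε'.trans (e : ↥(reflexFieldOf T') ≃ₐ[ℚ] ↥(reflexFieldOf T)).toRingEquiv, ?_, fun ψ => ?_⟩
    · refine RingHom.ext fun x => ?_
      have hx := RingHom.congr_fun hτ' x
      change C.τ (C.k x) = ι ((ε' x : ↥(reflexFieldOf T')) : L) at hx
      change conj (C.τ (C.k x)) = conj (ι ((e (ε' x) : ↥(reflexFieldOf T)) : L))
      rw [e_val, hx]
    · rw [hΦ' ψ]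
      have hs : ψ.comp ε'.symm.toRingHom =
          (ψ.comp (ε'.trans (e : ↥(reflexFieldOf T') ≃ₐ[ℚ] ↥(reflexFieldOf T)).toRingEquiv).symm.toRingHom).comp
            (e : ↥(reflexFieldOf T') →+* ↥(reflexFieldOf T)) :=
        RingHom.ext fun y => by
          change ψ (ε'.symm y) = ψ ((ε'.trans (e : ↥(reflexFieldOf T') ≃ₐ[ℚ] ↥(reflexFieldOf T)).toRingEquiv).symm (e y))
          rw [RingEquiv.symm_trans_apply]
          change ψ (ε'.symm y) = ψ (ε'.symm (e.symm (e y)))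
          rw [AlgEquiv.symm_apply_apply]
      rw [hs]
      exact (key _).symm

/-! ## §3 `IsReflexOfType` ∕ `IsReflexOfTypeG` of the conjugate record -/

/-- **`d̄.IsReflexOfType ι Φ ↔ d.IsReflexOfType ι Φ̄`** — conjugating the record (same variety, eigencharacter and class conjugated)
FLIPS the admissible type to the conjugate one. [cite: Liu2021, Definition 4.3, Remark 4.4] [cite: Shimura1998, §8.3 Prop. 28] -/
theorem isReflexOfType_conjRecord_iff (ι : (L : Type) →+* ℂ) (C : LiuCMSide) (Φ : CMType L) :
    (conjRecord C).IsReflexOfType ι Φ ↔ C.IsReflexOfType ι (bar Φ) := by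
  unfold LiuCMSide.IsReflexOfType
  exact isReflexOf_conjRecord_iff_of_reflexLift ι C _ _ (reflexFieldOf_autSet_bar_eq ι Φ)
    (mem_reflexLift_autSet_bar_iff ι Φ)

/-- The same against the conjugate PIN: `d̄.IsReflexOfType ι Φ ↔ d.IsReflexOfType ῑ Φ` (by K1). [cite: Liu2021, Definition 4.3, Remark 4.4] -/
theorem isReflexOfType_conjRecord_iff_conj (ι : (L : Type) →+* ℂ) (C : LiuCMSide) (Φ : CMType L) :
    (conjRecord C).IsReflexOfType ι Φ ↔ C.IsReflexOfType ((starRingEnd ℂ).comp ι) Φ := by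
  rw [isReflexOfType_conjRecord_iff, isReflexOfType_conj_iff]

/-- Galois-guarded form: `d̄.IsReflexOfTypeG ι Φ ↔ d.IsReflexOfTypeG ι Φ̄`. [cite: Liu2021, Definition 4.3, Remark 4.4] -/
theorem isReflexOfTypeG_conjRecord_iff (ι : (L : Type) →+* ℂ) (C : LiuCMSide) (Φ : CMType L) :
    (conjRecord C).IsReflexOfTypeG ι Φ ↔ C.IsReflexOfTypeG ι (bar Φ) := by
  unfold LiuCMSide.IsReflexOfTypeG
  exact imp_congr_right fun _ => isReflexOfType_conjRecord_iff ι C Φ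

/-- Galois-guarded form against the conjugate pin: `d̄.IsReflexOfTypeG ι Φ ↔ d.IsReflexOfTypeG ῑ Φ`. [cite: Liu2021, Definition 4.3, Remark 4.4] -/
theorem isReflexOfTypeG_conjRecord_iff_conj (ι : (L : Type) →+* ℂ) (C : LiuCMSide) (Φ : CMType L) :
    (conjRecord C).IsReflexOfTypeG ι Φ ↔ C.IsReflexOfTypeG ((starRingEnd ℂ).comp ι) Φ := by
  rw [isReflexOfTypeG_conjRecord_iff, isReflexOfTypeG_conj_iff]

/-- Symmetric form (`d̄̄ = d`): `d.IsReflexOfTypeG ι Φ ↔ d̄.IsReflexOfTypeG ι Φ̄`. [cite: Liu2021, Definition 4.3, Remark 4.4] -/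
theorem isReflexOfTypeG_iff_conjRecord_bar (ι : (L : Type) →+* ℂ) (C : LiuCMSide) (Φ : CMType L) :
    C.IsReflexOfTypeG ι Φ ↔ (conjRecord C).IsReflexOfTypeG ι (bar Φ) := by
  rw [← isReflexOfTypeG_conjRecord_iff ι (conjRecord C) Φ, conjRecord_conjRecord]

/-- Symmetric form against the conjugate pin: `d.IsReflexOfTypeG ι Φ ↔ d̄.IsReflexOfTypeG ῑ Φ`. [cite: Liu2021, Definition 4.3, Remark 4.4] -/
theorem isReflexOfTypeG_iff_conjRecord_conj (ι : (L : Type) →+* ℂ) (C : LiuCMSide) (Φ : CMType L) :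
    C.IsReflexOfTypeG ι Φ ↔ (conjRecord C).IsReflexOfTypeG ((starRingEnd ℂ).comp ι) Φ := by
  rw [← isReflexOfTypeG_conjRecord_iff_conj ι (conjRecord C) Φ, conjRecord_conjRecord]

/-! ## §4 Generator sets: re-keying the admissibility of ONE character at `ῑ₁` (or at the conjugate type) conjugates the generator set -/

section Classes

open HodgeCM HodgeCM.Model HodgeCM.Model.LiuDictionary
open Literature.AlgebraicGeometry.HodgeTheory (exists_isReal_hodgeModel hodgePQ_independent_of_hodgeModel)
open Literature.NumberTheory.Automorphic.PicardCM (BallQuotientUniformised CMAbelianVarietyRealised)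
open Literature.NumberTheory.Transcendental (Arapura2012_Cor_15_4_6)

variable {hHD : exists_isReal_hodgeModel} {hI : hodgePQ_independent_of_hodgeModel}
  {h₁ : BallQuotientUniformised} {h₃ : CMAbelianVarietyRealised}
variable {ι₁ : (L : Type) →+* ℂ} {V : HermSpace3 L ι₁}

/-- **Two dictionaries at one pin, one keyed `(ι₁, Φ)` at `μ`, the other `(ῑ₁, Φ)` at `μf`: `cmClasses′ K μf = (conj ⊗ id) '' cmClasses K μ`.**
wb-5 g1's frame `cmClasses_eq_image_conj_of_adm_conjRecord` with its hypothesis DISCHARGED by `isReflexOfTypeG_conjRecord_iff_conj`.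
[cite: Liu2021, Definition 4.3, Remark 4.4] [cite: VoisinHodgeI2002, §6.1.3 Cor. 6.12] -/
theorem cmClasses_eq_image_conj_of_adm_conjKey (T Tf : LiuDictionary hHD hI h₁ h₃ V) (K : Level V) (μ : T.Char) (μf : Tf.Char)
    (Φ : CMType L)
    (hT : ∀ d : LiuCMSide, T.adm μ d ↔ d.IsReflexOfTypeG ι₁ Φ)
    (hTf : ∀ d : LiuCMSide, Tf.adm μf d ↔ d.IsReflexOfTypeG ((starRingEnd ℂ).comp ι₁) Φ) :
    Tf.cmClasses K μf = Literature.AlgebraicGeometry.Motives.HodgeStructure.conj '' T.cmClasses K μ :=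
  cmClasses_eq_image_conj_of_adm_conjRecord T Tf K μ μf fun d => by
    rw [hTf d, hT (conjRecord d), isReflexOfTypeG_conjRecord_iff_conj]

/-- **The same with the second dictionary keyed `(ι₁, Φ̄)`** (same pin, CONJUGATE type — e.g. the live dictionary at a line of conjugate type):
`cmClasses′ K μf = (conj ⊗ id) '' cmClasses K μ`. [cite: Liu2021, Definition 4.3, Remark 4.4] [cite: VoisinHodgeI2002, §6.1.3 Cor. 6.12] -/
theorem cmClasses_eq_image_conj_of_adm_bar (T Tf : LiuDictionary hHD hI h₁ h₃ V) (K : Level V) (μ : T.Char) (μf : Tf.Char)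
    (Φ : CMType L)
    (hT : ∀ d : LiuCMSide, T.adm μ d ↔ d.IsReflexOfTypeG ι₁ Φ)
    (hTf : ∀ d : LiuCMSide, Tf.adm μf d ↔ d.IsReflexOfTypeG ι₁ (bar Φ)) :
    Tf.cmClasses K μf = Literature.AlgebraicGeometry.Motives.HodgeStructure.conj '' T.cmClasses K μ :=
  cmClasses_eq_image_conj_of_adm_conjRecord T Tf K μ μf fun d => by
    rw [hTf d, hT (conjRecord d), isReflexOfTypeG_conjRecord_iff]

variable (V) (I : Type) (line : I → SplitLineE V)

/-- **«T♭ = 𝔇ʰ as sets» AT THE LITERAL PIN.**  The generator set of the HYBRID dictionary `𝔇ʰ` (wb-1: the pinned tower dictionary with ONLY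
the admissibility of each line re-keyed at `ῑ₁ = conj ∘ ι₁`, the form the re-key∕J-record lane supplies) at a line `i` IS the complex
conjugate `(conj ⊗ id) ''` of the LIVE generator set `(liuDictionaryPin …).cmClasses K i` of the SAME line. [cite: Liu2021, Definition 4.3, Remark 4.4] [cite: VoisinHodgeI2002, §6.1.3 Cor. 6.12] -/
theorem cmClasses_conjAdm_pin_eq_image_conj (hHD : exists_isReal_hodgeModel) (hI : hodgePQ_independent_of_hodgeModel)
    (h₁ : BallQuotientUniformised) (h₃ : CMAbelianVarietyRealised) (hA : Arapura2012_Cor_15_4_6) (K : Level V) (i : I) :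
    (LiuDictionary.ofTower hHD hI h₁ h₃ hA V I (fun i => {χ : (line i).CharW // (line i).IsAutChar χ})
      (fun i a => (line i).Ω (ιVE V) a.1) (fun i => SplitLine.PhiMuLine ι₁ (line i))
      (fun i dd => dd.IsReflexOfTypeG ((starRingEnd ℂ).comp ι₁) (SplitLine.typeOfLine (line i)))).cmClasses K i =
    Literature.AlgebraicGeometry.Motives.HodgeStructure.conj '' (liuDictionaryPin hHD hI h₁ h₃ hA V I line).cmClasses K i :=
  cmClasses_eq_image_conj_of_adm_conjKey (liuDictionaryPin hHD hI h₁ h₃ hA V I line)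
    (LiuDictionary.ofTower hHD hI h₁ h₃ hA V I (fun i => {χ : (line i).CharW // (line i).IsAutChar χ})
      (fun i a => (line i).Ω (ιVE V) a.1) (fun i => SplitLine.PhiMuLine ι₁ (line i))
      (fun i dd => dd.IsReflexOfTypeG ((starRingEnd ℂ).comp ι₁) (SplitLine.typeOfLine (line i))))
    K i i (SplitLine.typeOfLine (line i)) (fun _ => Iff.rfl) (fun _ => Iff.rfl)

/-- **LIVE generator sets of a line and of a line of CONJUGATE type are complex conjugates.**  At the literal pin, if
`typeOfLine (line ī) = bar (typeOfLine (line i))` (the mirror line: `muLiu ῑ₁ = −muLiu ι₁`), then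
`cmClasses K ī = (conj ⊗ id) '' cmClasses K i`. [cite: Liu2021, Definition 4.3, Remark 4.4] [cite: VoisinHodgeI2002, §6.1.3 Cor. 6.12] -/
theorem cmClasses_pin_eq_image_conj_of_typeOfLine_eq_bar (hHD : exists_isReal_hodgeModel)
    (hI : hodgePQ_independent_of_hodgeModel) (h₁ : BallQuotientUniformised) (h₃ : CMAbelianVarietyRealised)
    (hA : Arapura2012_Cor_15_4_6) (K : Level V) (i ī : I)
    (hī : SplitLine.typeOfLine (line ī) = bar (SplitLine.typeOfLine (line i))) :
    (liuDictionaryPin hHD hI h₁ h₃ hA V I line).cmClasses K ī =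
      Literature.AlgebraicGeometry.Motives.HodgeStructure.conj '' (liuDictionaryPin hHD hI h₁ h₃ hA V I line).cmClasses K i :=
  cmClasses_eq_image_conj_of_adm_bar (liuDictionaryPin hHD hI h₁ h₃ hA V I line) (liuDictionaryPin hHD hI h₁ h₃ hA V I line)
    K i ī (SplitLine.typeOfLine (line i)) (fun _ => Iff.rfl) fun d => by
      change d.IsReflexOfTypeG ι₁ (SplitLine.typeOfLine (line ī)) ↔ _
      rw [hī]

end Classes

end Summit.HodgeConjecture.CorCM.D2Bridge

end
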